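import Summits.Ventures.PercRepro.ProfileFlatUpsetLineSwap

/-!
# PercRepro — THE SWAP IDENTITY: (G) ON `2r − 2` POINTS AT ANY FLAT IS AN EXCESS INEQUALITY
(p10, gen 20; `proofs/P10-AVFULL.md` §28(k))

`M` of rank `r` on `N = 2r − 2` points, `F₀` ANY flat, `U = principalUp M F₀`; `negTwo` / `posTwo` the separated sets
with `r − 1` / `r` points.  THE SWAP at a point `c ∈ F₀`: a negative `Z` and a positive `B` are related when
`B = (E ∖ Z) ∪ c` for some `c ∈ Z ∩ F₀` (`E ∖ Z ⊆ B ∧ B ∖ (E ∖ Z) ⊆ F₀`); the swap points of `Z` are `swapOut M F₀ Z = {c ∈ Z ∩ F₀ :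
c ∉ cl (E ∖ Z)}` (never empty: `swapOut_nonempty`) and the swap points of `B` are `swapIn M F₀ B = {c ∈ B ∩ F₀ :
c ∉ cl (E ∖ B), F₀ ⊆ cl ((E ∖ B) ∪ c)}`.  Both count the relation exactly (`card_swapOut_eq_card_bipartiteAbove`,
`card_swapIn_eq_card_bipartiteBelow`), so Mathlib's double counting gives `Σ_Z #swapOut Z = Σ_B #swapIn B` and
THE SWAP IDENTITY (`card_posTwo_add_excess_eq`):
`#posTwo + Σ_{B : swapIn B ≠ ∅} (#swapIn B − 1) = #negTwo + #freeTwo + Σ_Z (#swapOut Z − 1)`,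
`freeTwo = {B ∈ posTwo : swapIn B = ∅}`.  COROLLARY (`sum_sepSets_principal_nonneg_of_excess_le`): on `2r − 2` points
(G) at `↑F₀` follows from the EXCESS INEQUALITY `Σ_{B : swapIn B ≠ ∅} (#swapIn B − 1) ≤ #freeTwo + Σ_Z (#swapOut Z − 1)`
— and is equivalent to it.  For a two-point line this is the identity `#pos − #neg = #both + #free − #dep` of the
rank-5 module (`swapOut Z` has two points exactly on `bothL`, `swapIn B` two points exactly on `depL`).  Census (own
code, gen 20, excess8.py): the identity is exact on all 27,184 instances `(M, F₀)` with a negative set at `n = 8`; the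
sharper inequality WITHOUT the `freeTwo` term holds at every rank-`1` and rank-`2` flat but fails at `32 / 9,776`
rank-`3` three-point flats and `8 / 383` rank-`4` six-point flats — the free sets are needed in general.  Nothing here
asserts (G).
-/

open scoped Matroid

namespace PercRepro.Cogirth

open Finset ThmH Skew

variable {α : Type} [DecidableEq α] {M : Matroid α} [M.Finite]

/-! ### The swap points -/

/-- The swap points of a negative set: the points of `Z ∩ F₀` not spanned by the complement. -/
noncomputable def swapOut (M : Matroid α) [M.Finite] (F₀ Z : Finset α) : Finset α :=
  (Z ∩ F₀).filter (fun c => c ∉ clF M (gr M \ Z))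

/-- The swap points of a positive set: the points `c ∈ B ∩ F₀` with `(E ∖ B) ∪ c` independent and spanning `F₀`. -/
noncomputable def swapIn (M : Matroid α) [M.Finite] (F₀ B : Finset α) : Finset α :=
  (B ∩ F₀).filter (fun c => c ∉ clF M (gr M \ B) ∧ F₀ ⊆ clF M (insert c (gr M \ B)))

/-- The positive sets without a swap point. -/
noncomputable def freeTwo (M : Matroid α) [M.Finite] (F₀ : Finset α) : Finset (Finset α) :=
  (posTwo M F₀).filter (fun B => swapIn M F₀ B = ∅)

/-- Membership in `swapOut`. -/
theorem mem_swapOut {F₀ Z c : _} : c ∈ swapOut M F₀ Z ↔ (c ∈ Z ∧ c ∈ F₀) ∧ c ∉ clF M (gr M \ Z) := by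
  unfold swapOut; rw [mem_filter, mem_inter]

/-- Membership in `swapIn`. -/
theorem mem_swapIn {F₀ B c : _} : c ∈ swapIn M F₀ B ↔
    (c ∈ B ∧ c ∈ F₀) ∧ c ∉ clF M (gr M \ B) ∧ F₀ ⊆ clF M (insert c (gr M \ B)) := by
  unfold swapIn; rw [mem_filter, mem_inter]

/-- A negative set has a swap point: some point of `F₀` is outside `cl (E ∖ Z)`, and it lies in `Z`. -/
theorem swapOut_nonempty {F₀ : Finset α} (hF : IsFlatF M F₀) {Z : Finset α} (hZ : Z ∈ negTwo M F₀) :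
    (swapOut M F₀ Z).Nonempty := by
  obtain ⟨hZs, _⟩ := mem_negTwo.1 hZ
  obtain ⟨_, hout⟩ := subset_clF_of_mem_sepSets_principal hZs
  have hex : ∃ c ∈ F₀, c ∉ clF M (gr M \ Z) := by
    by_contra hcon
    exact hout (fun c hc => by by_contra h; exact hcon ⟨c, hc, h⟩)
  obtain ⟨c, hcF, hccl⟩ := hex
  refine ⟨c, mem_swapOut.2 ⟨⟨?_, hcF⟩, hccl⟩⟩
  by_contra hcZ
  exact hccl (subset_clF_fu sdiff_subset (mem_sdiff.2 ⟨hF.1 hcF, hcZ⟩))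

/-! ### The swap relation counted from both sides -/

/-- The swap points of a negative `Z` are in bijection with the positive sets `B` with `E ∖ Z ⊆ B ∧ B ∖ (E ∖ Z) ⊆ F₀`. -/
theorem card_swapOut_eq_card_bipartiteAbove {F₀ : Finset α} (hF : IsFlatF M F₀)
    (hN : (gr M).card + 2 = 2 * rk M (gr M)) {Z : Finset α} (hZ : Z ∈ negTwo M F₀) :
    (swapOut M F₀ Z).card = ((posTwo M F₀).bipartiteAbove (fun (Z B : Finset α) => gr M \ Z ⊆ B ∧ B \ (gr M \ Z) ⊆ F₀) Z).card := by
  obtain ⟨hZs, hZc⟩ := mem_negTwo.1 hZ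
  obtain ⟨_, _, hsum⟩ := bounds_of_mem_sepSets_principal hF hZs
  obtain ⟨hZg, _, hZcr⟩ := mem_biIndepAll.1 (mem_sepSets.1 hZs).1
  apply card_bij (fun c _ => insert c (gr M \ Z))
  · intro c hc
    rw [mem_swapOut] at hc
    rw [mem_bipartiteAbove]
    refine ⟨insert_sdiff_mem_posTwo hF hN hc.1.2 hZ hc.1.1 hc.2, subset_insert _ _, ?_⟩
    intro y hy
    rw [mem_sdiff, mem_insert] at hy
    rcases hy.1 with h | h
    · exact h ▸ hc.1.2
    · exact absurd h hy.2
  · intro c₁ hc₁ c₂ hc₂ heq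
    rw [mem_swapOut] at hc₁ hc₂
    have h1 : c₁ ∈ insert c₂ (gr M \ Z) := by rw [← heq]; exact mem_insert_self _ _
    rw [mem_insert, mem_sdiff] at h1
    rcases h1 with h | h
    · exact h
    · exact absurd hc₁.1.1 h.2
  · intro B hB
    rw [mem_bipartiteAbove] at hB
    obtain ⟨hBp, hsub, hF₀⟩ := hB
    obtain ⟨hBs, hBc⟩ := mem_posTwo.1 hBp
    obtain ⟨hBg, hBr, _⟩ := mem_biIndepAll.1 (mem_sepSets.1 hBs).1
    have hone : (B \ (gr M \ Z)).card = 1 := by rw [card_sdiff_of_subset hsub]; omega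
    obtain ⟨c, hc⟩ := card_eq_one.1 hone
    have hcmem : c ∈ B \ (gr M \ Z) := by rw [hc]; exact mem_singleton_self c
    have hcF : c ∈ F₀ := hF₀ hcmem
    rw [mem_sdiff, mem_sdiff, not_and, not_not] at hcmem
    have hcZ : c ∈ Z := hcmem.2 (hBg hcmem.1)
    have hBeq : B = insert c (gr M \ Z) := by rw [insert_eq, ← hc, sdiff_union_of_subset hsub]
    refine ⟨c, mem_swapOut.2 ⟨⟨hcZ, hcF⟩, ?_⟩, hBeq.symm⟩
    -- `c ∉ cl (E ∖ Z)`: `B = (E ∖ Z) ∪ c` is independent of size `r`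
    intro hccl
    have hcg : c ∈ gr M := hBg hcmem.1
    have h1 : rk M (insert c (gr M \ Z)) = rk M (gr M \ Z) := (mem_clF_iff_rk_insert_eq hcg sdiff_subset).1 hccl
    rw [← hBeq, hBr, hBc, hZcr] at h1
    omega

/-- The swap points of a positive `B` are in bijection with the negative sets `Z` with `E ∖ Z ⊆ B ∧ B ∖ (E ∖ Z) ⊆ F₀`. -/
theorem card_swapIn_eq_card_bipartiteBelow {F₀ : Finset α} (hF : IsFlatF M F₀)
    (hN : (gr M).card + 2 = 2 * rk M (gr M)) {B : Finset α} (hB : B ∈ posTwo M F₀) :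
    (swapIn M F₀ B).card = ((negTwo M F₀).bipartiteBelow (fun (Z B : Finset α) => gr M \ Z ⊆ B ∧ B \ (gr M \ Z) ⊆ F₀) B).card := by
  obtain ⟨hBs, hBc⟩ := mem_posTwo.1 hB
  obtain ⟨_, _, hsum⟩ := bounds_of_mem_sepSets_principal hF hBs
  have hBb : B ∈ biIndepAll M := (mem_sepSets.1 hBs).1
  obtain ⟨hBg, hBr, hBcr⟩ := mem_biIndepAll.1 hBb
  have hB'b : gr M \ B ∈ biIndepAll M := sdiff_mem_biIndepAll hBb
  apply card_bij (fun c _ => insert c (gr M \ B))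
  · intro c hc
    rw [mem_swapIn] at hc
    obtain ⟨⟨hcB, hcF⟩, hccl, hspan⟩ := hc
    have hcg : c ∈ gr M := hBg hcB
    have hcB' : c ∉ gr M \ B := fun h => (mem_sdiff.1 h).2 hcB
    have hcomp : gr M \ insert c (gr M \ B) = B.erase c := sdiff_insert_sdiff_eq_erase_line hBg c
    rw [mem_bipartiteBelow]
    refine ⟨?_, ?_⟩
    · rw [mem_negTwo, mem_sepSets]
      refine ⟨⟨(insert_mem_biIndepAll_iff hB'b hcg hcB').2 hccl, clF_mem_principalUp_of_subset hspan, ?_⟩, ?_⟩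
      · rw [hcomp]
        intro hcon
        rw [mem_principalUp] at hcon
        exact notMem_clF_erase_of_rk_eq_card hcg hBg hBr hcB (hcon.2.2 hcF)
      · rw [card_insert_of_notMem hcB']; omega
    · rw [hcomp]
      refine ⟨erase_subset c B, ?_⟩
      intro y hy
      rw [mem_sdiff, mem_erase, not_and] at hy
      by_cases hyc : y = c
      · exact hyc ▸ hcF
      · exact absurd hy.1 (hy.2 hyc)
  · intro c₁ hc₁ c₂ hc₂ heq
    rw [mem_swapIn] at hc₁ hc₂
    have h1 : c₁ ∈ insert c₂ (gr M \ B) := by rw [← heq]; exact mem_insert_self _ _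
    rw [mem_insert, mem_sdiff] at h1
    rcases h1 with h | h
    · exact h
    · exact absurd hc₁.1.1 h.2
  · intro Z hZ
    rw [mem_bipartiteBelow] at hZ
    obtain ⟨hZn, hsub, hF₀⟩ := hZ
    obtain ⟨hZs, hZc⟩ := mem_negTwo.1 hZn
    obtain ⟨hin, _⟩ := subset_clF_of_mem_sepSets_principal hZs
    obtain ⟨hZg, hZr, _⟩ := mem_biIndepAll.1 (mem_sepSets.1 hZs).1
    obtain ⟨_, _, hsumZ⟩ := bounds_of_mem_sepSets_principal hF hZs
    have hone : (B \ (gr M \ Z)).card = 1 := by rw [card_sdiff_of_subset hsub]; omega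
    obtain ⟨c, hc⟩ := card_eq_one.1 hone
    have hcmem : c ∈ B \ (gr M \ Z) := by rw [hc]; exact mem_singleton_self c
    have hcF : c ∈ F₀ := hF₀ hcmem
    rw [mem_sdiff, mem_sdiff, not_and, not_not] at hcmem
    have hcZ : c ∈ Z := hcmem.2 (hBg hcmem.1)
    have hBeq : B = insert c (gr M \ Z) := by rw [insert_eq, ← hc, sdiff_union_of_subset hsub]
    have hZeq : insert c (gr M \ B) = Z := by
      rw [hBeq, sdiff_insert, Finset.sdiff_sdiff_eq_self hZg, insert_erase hcZ]
    refine ⟨c, mem_swapIn.2 ⟨⟨hcmem.1, hcF⟩, ?_, ?_⟩, hZeq⟩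
    · -- `Z = (E ∖ B) ∪ c` is independent
      intro hccl
      have hcg : c ∈ gr M := hBg hcmem.1
      have h1 : rk M (insert c (gr M \ B)) = rk M (gr M \ B) := (mem_clF_iff_rk_insert_eq hcg sdiff_subset).1 hccl
      rw [hZeq, hZr, hBcr] at h1
      omega
    · rw [hZeq]; exact hin

/-- **The two counts of the swap relation agree**: `Σ_Z #swapOut Z = Σ_B #swapIn B`. -/
theorem sum_card_swapOut_eq_sum_card_swapIn {F₀ : Finset α} (hF : IsFlatF M F₀)
    (hN : (gr M).card + 2 = 2 * rk M (gr M)) :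
    ∑ Z ∈ negTwo M F₀, (swapOut M F₀ Z).card = ∑ B ∈ posTwo M F₀, (swapIn M F₀ B).card := by
  rw [sum_congr rfl (fun Z hZ => card_swapOut_eq_card_bipartiteAbove hF hN hZ),
    sum_congr rfl (fun B hB => card_swapIn_eq_card_bipartiteBelow hF hN hB)]
  exact sum_card_bipartiteAbove_eq_sum_card_bipartiteBelow (fun (Z B : Finset α) => gr M \ Z ⊆ B ∧ B \ (gr M \ Z) ⊆ F₀)

/-! ### The swap identity and the excess inequality -/

/-- **THE SWAP IDENTITY** on `2r − 2` points at any flat: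
`#posTwo + Σ_{B : swapIn B ≠ ∅} (#swapIn B − 1) = #negTwo + #freeTwo + Σ_Z (#swapOut Z − 1)`. -/
theorem card_posTwo_add_excess_eq {F₀ : Finset α} (hF : IsFlatF M F₀) (hN : (gr M).card + 2 = 2 * rk M (gr M)) :
    (posTwo M F₀).card + ∑ B ∈ (posTwo M F₀).filter (fun B => swapIn M F₀ B ≠ ∅), ((swapIn M F₀ B).card - 1) =
      (negTwo M F₀).card + (freeTwo M F₀).card + ∑ Z ∈ negTwo M F₀, ((swapOut M F₀ Z).card - 1) := by
  have hT := sum_card_swapOut_eq_sum_card_swapIn hF hN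
  -- the negative side: `Σ_Z #swapOut Z = Σ_Z (#swapOut Z − 1) + #negTwo`
  have hneg : ∑ Z ∈ negTwo M F₀, (swapOut M F₀ Z).card =
      ∑ Z ∈ negTwo M F₀, ((swapOut M F₀ Z).card - 1) + (negTwo M F₀).card := by
    rw [card_eq_sum_ones (negTwo M F₀), ← sum_add_distrib]
    apply sum_congr rfl
    intro Z hZ
    have := card_pos.2 (swapOut_nonempty hF hZ)
    omega
  -- the positive side: `Σ_B #swapIn B = Σ_{swapIn ≠ ∅} (#swapIn B − 1) + #{swapIn ≠ ∅}`
  have hpos : ∑ B ∈ posTwo M F₀, (swapIn M F₀ B).card =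
      ∑ B ∈ (posTwo M F₀).filter (fun B => swapIn M F₀ B ≠ ∅), ((swapIn M F₀ B).card - 1) +
        ((posTwo M F₀).filter (fun B => swapIn M F₀ B ≠ ∅)).card := by
    rw [← sum_filter_add_sum_filter_not (posTwo M F₀) (fun B => swapIn M F₀ B ≠ ∅)]
    have h0 : ∑ B ∈ (posTwo M F₀).filter (fun B => ¬ swapIn M F₀ B ≠ ∅), (swapIn M F₀ B).card = 0 := by
      apply sum_eq_zero
      intro B hB
      rw [mem_filter, not_not] at hB
      rw [hB.2, card_empty]
    rw [h0, add_zero, card_eq_sum_ones ((posTwo M F₀).filter _), ← sum_add_distrib]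
    apply sum_congr rfl
    intro B hB
    rw [mem_filter] at hB
    have := card_pos.2 (nonempty_iff_ne_empty.2 hB.2)
    omega
  -- `#posTwo = #freeTwo + #{swapIn ≠ ∅}`
  have hsplit : (freeTwo M F₀).card + ((posTwo M F₀).filter (fun B => swapIn M F₀ B ≠ ∅)).card =
      (posTwo M F₀).card := by
    unfold freeTwo
    exact card_filter_add_card_filter_not (fun B => swapIn M F₀ B = ∅)
  omega

/-- **THE REDUCTION**: on `2r − 2` points, (G) at `↑F₀` follows from the excess inequality
`Σ_{B : swapIn B ≠ ∅} (#swapIn B − 1) ≤ #freeTwo + Σ_Z (#swapOut Z − 1)`. -/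
theorem sum_sepSets_principal_nonneg_of_excess_le {F₀ : Finset α} (hF : IsFlatF M F₀)
    (hN : (gr M).card + 2 = 2 * rk M (gr M))
    (hex : ∑ B ∈ (posTwo M F₀).filter (fun B => swapIn M F₀ B ≠ ∅), ((swapIn M F₀ B).card - 1) ≤
      (freeTwo M F₀).card + ∑ Z ∈ negTwo M F₀, ((swapOut M F₀ Z).card - 1)) :
    0 ≤ ∑ Z ∈ sepSets M (principalUp M F₀), (2 * (Z.card : ℤ) - (gr M).card - 1) := by
  have hid := card_posTwo_add_excess_eq hF hN
  have hle : (negTwo M F₀).card ≤ (posTwo M F₀).card := by omega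
  rw [sum_term_eq_of_subset hF hN (Subset.refl _)]
  have hP : (sepSets M (principalUp M F₀)).filter (fun Z => Z ∈ posTwo M F₀) = posTwo M F₀ := by
    ext Z; rw [mem_filter]; exact ⟨fun h => h.2, fun h => ⟨(mem_posTwo.1 h).1, h⟩⟩
  have hN'' : (sepSets M (principalUp M F₀)).filter (fun Z => Z ∈ negTwo M F₀) = negTwo M F₀ := by
    ext Z; rw [mem_filter]; exact ⟨fun h => h.2, fun h => ⟨(mem_negTwo.1 h).1, h⟩⟩
  rw [hP, hN'']
  have h' : ((negTwo M F₀).card : ℤ) ≤ (posTwo M F₀).card := by exact_mod_cast hle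
  linarith

/-- Conversely, (G) at `↑F₀` on `2r − 2` points gives the excess inequality: the two are equivalent. -/
theorem excess_le_of_sum_sepSets_principal_nonneg {F₀ : Finset α} (hF : IsFlatF M F₀)
    (hN : (gr M).card + 2 = 2 * rk M (gr M))
    (hG : 0 ≤ ∑ Z ∈ sepSets M (principalUp M F₀), (2 * (Z.card : ℤ) - (gr M).card - 1)) :
    ∑ B ∈ (posTwo M F₀).filter (fun B => swapIn M F₀ B ≠ ∅), ((swapIn M F₀ B).card - 1) ≤
      (freeTwo M F₀).card + ∑ Z ∈ negTwo M F₀, ((swapOut M F₀ Z).card - 1) := by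
  have hid := card_posTwo_add_excess_eq hF hN
  rw [sum_term_eq_of_subset hF hN (Subset.refl _)] at hG
  have hP : (sepSets M (principalUp M F₀)).filter (fun Z => Z ∈ posTwo M F₀) = posTwo M F₀ := by
    ext Z; rw [mem_filter]; exact ⟨fun h => h.2, fun h => ⟨(mem_posTwo.1 h).1, h⟩⟩
  have hN'' : (sepSets M (principalUp M F₀)).filter (fun Z => Z ∈ negTwo M F₀) = negTwo M F₀ := by
    ext Z; rw [mem_filter]; exact ⟨fun h => h.2, fun h => ⟨(mem_negTwo.1 h).1, h⟩⟩
  rw [hP, hN''] at hG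
  have hle : (negTwo M F₀).card ≤ (posTwo M F₀).card := by
    have : ((negTwo M F₀).card : ℤ) ≤ (posTwo M F₀).card := by linarith
    exact_mod_cast this
  omega

end PercRepro.Cogirth
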